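import Summits.Ventures.PercRepro.OneEdgeMonoAB

/-!
# PercRepro — the `c–a` / `c–b` edges of `OneEdgeMonoC026` are theorems: the closed-cluster flip (p1, gen 5)

At an edge `e` joining `c` and `a` the hypothesis is the counting inequality on `H = G − e`
`#{S : a ≁ b, b ~ c, c iso in S̄} ≤ #{S : a ≁ b, b ≁ c}` (`deleteEdge_le_iff_of_isCAEdge`, `OneEdgeMonoAB.lean`).
The injection: let `Q` be the **closed cluster** of `c` — the cluster of `c` in the antipode `S̄` inside `H`
(`closedCluster`), which avoids `a` and `b` — and flip every edge other than `e` with an endpoint in `Q`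
(`flipQ`).  Every edge leaving `Q` was open (else it would extend the closed cluster), so it closes; the closed
edges inside `Q` open and keep `Q` connected; hence the cluster of `c` in the image is exactly `Q`
(`cluster_flipQ_eq`), so `b ≁ c` there, `a ≁ b` survives (paths from `a` never enter `Q`,
`conn_of_conn_flipQ`), and `S` is recovered from the image as `T Δ E[Q]` (`flipQ_injOn`).  Exact check of
the map on every simple graph with `n ≤ 5` and `n = 6, m ≤ 9` (15,461 graphs): 0 misses, 0 collisions.

* **`closedCluster`**, **`flipQ`** and its four properties;
* **`card_crosswise_le_of_isCAEdge`** — the counting inequality, on every marked multigraph;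
* **`cubeSumQuad_deleteEdge_le_of_isCAEdge`** — `CS(G − e) ≤ CS(G)` at every `c–a` edge;
* **`cubeSumQuad_kernel26_swap`** (the `a ↔ b` symmetry of the class sum) and
  **`cubeSumQuad_deleteEdge_le_of_isCBEdge`** — the same at every `c–b` edge;
* **`cubeSumQuad_deleteEdge_le_of_markMark`** — the whole mark–mark type of the hypothesis is a theorem;
* **`OneEdgeMonoC026Res`**, **`oneEdgeMonoC026_iff_res`** — hence the hypothesis of record is equivalent to its
  restriction to the edges with no endpoint in `{a, b}` (the `c`–non-mark and non-mark–non-mark edges).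
-/

namespace PercRepro

open Finset

namespace MultiGraph

variable {V E : Type*} (G : MultiGraph V E) [DecidableEq E]

/-! ### The closed cluster of `c` and the closed-cluster flip -/

/-- **The closed cluster of `c` inside `G − e`**: the cluster of `c` in the antipode of `ρ` with `e` re-closed. -/
def closedCluster (c : V) (e : E) (ρ : Config E) : Set V :=
  G.cluster (Function.update ρᶜ e false) c

/-- Membership in the closed cluster. -/
theorem mem_closedCluster {c : V} {e : E} {ρ : Config E} {u : V} :
    u ∈ G.closedCluster c e ρ ↔ G.Conn (Function.update ρᶜ e false) c u := Iff.rfl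

/-- `c` lies in its closed cluster. -/
theorem self_mem_closedCluster (c : V) (e : E) (ρ : Config E) : c ∈ G.closedCluster c e ρ :=
  Conn.refl G _ c

open Classical in
/-- **The closed-cluster flip**: flip every edge other than `e` with an endpoint in the closed cluster of `c`. -/
noncomputable def flipQ (c : V) (e : E) (ρ : Config E) : Config E :=
  fun f => if f ≠ e ∧ (G.fst f ∈ G.closedCluster c e ρ ∨ G.snd f ∈ G.closedCluster c e ρ) then !ρ f
    else ρ f

/-- The flip leaves `e` alone. -/
theorem flipQ_apply_e (c : V) (e : E) (ρ : Config E) : G.flipQ c e ρ e = ρ e := by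
  unfold flipQ
  rw [if_neg fun h => h.1 rfl]

/-- The flip on an edge touching the closed cluster. -/
theorem flipQ_apply_of_mem (c : V) (e : E) (ρ : Config E) {f : E} (hf : f ≠ e)
    (h : G.fst f ∈ G.closedCluster c e ρ ∨ G.snd f ∈ G.closedCluster c e ρ) :
    G.flipQ c e ρ f = !ρ f := by
  unfold flipQ
  rw [if_pos ⟨hf, h⟩]

/-- The flip on an edge not touching the closed cluster. -/
theorem flipQ_apply_of_not (c : V) (e : E) (ρ : Config E) {f : E}
    (h : ¬ (G.fst f ∈ G.closedCluster c e ρ ∨ G.snd f ∈ G.closedCluster c e ρ)) :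
    G.flipQ c e ρ f = ρ f := by
  unfold flipQ
  rw [if_neg fun h' => h h'.2]

/-- An edge of `G − e` leaving the closed cluster is open in `ρ` (else it would extend the cluster). -/
theorem open_of_boundary {c : V} {e : E} {ρ : Config E} (_hρ : ρ e = false) {f : E} (hf : f ≠ e)
    (h1 : G.fst f ∈ G.closedCluster c e ρ) (h2 : G.snd f ∉ G.closedCluster c e ρ) : ρ f = true := by
  by_contra h
  have h0 : ρ f = false := by simpa using h
  have h' : Function.update ρᶜ e false f = true := by
    rw [Function.update_of_ne hf, compl_apply_bool, h0]
    rfl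
  exact h2 (h1.trans (Conn.of_openAdj (G.openAdj_of_open f h')))

/-- The symmetric form of `open_of_boundary`. -/
theorem open_of_boundary' {c : V} {e : E} {ρ : Config E} (_hρ : ρ e = false) {f : E} (hf : f ≠ e)
    (h1 : G.snd f ∈ G.closedCluster c e ρ) (h2 : G.fst f ∉ G.closedCluster c e ρ) : ρ f = true := by
  by_contra h
  have h0 : ρ f = false := by simpa using h
  have h' : Function.update ρᶜ e false f = true := by
    rw [Function.update_of_ne hf, compl_apply_bool, h0]
    rfl
  exact h2 (h1.trans (Conn.of_openAdj (G.openAdj_of_open f h')).symm)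

/-- **No open edge of the flipped configuration crosses the boundary of the closed cluster.** -/
theorem flipQ_closed_boundary {c : V} {e : E} {ρ : Config E} (hρ : ρ e = false) :
    ∀ f, G.flipQ c e ρ f = true → (G.fst f ∈ G.closedCluster c e ρ ↔ G.snd f ∈ G.closedCluster c e ρ) := by
  intro f hf
  by_cases hfe : f = e
  · subst hfe
    rw [G.flipQ_apply_e, hρ] at hf
    exact absurd hf Bool.false_ne_true
  · constructor
    · intro h1
      by_contra h2
      rw [G.flipQ_apply_of_mem c e ρ hfe (Or.inl h1), G.open_of_boundary hρ hfe h1 h2] at hf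
      exact absurd hf (by decide)
    · intro h2
      by_contra h1
      rw [G.flipQ_apply_of_mem c e ρ hfe (Or.inr h2), G.open_of_boundary' hρ hfe h2 h1] at hf
      exact absurd hf (by decide)

/-- In the flipped configuration nothing inside the closed cluster connects to anything outside it. -/
theorem not_conn_flipQ_of_mem_of_notMem {c : V} {e : E} {ρ : Config E} (hρ : ρ e = false) {u v : V}
    (hu : u ∈ G.closedCluster c e ρ) (hv : v ∉ G.closedCluster c e ρ) : ¬ G.Conn (G.flipQ c e ρ) u v :=
  fun h => hv (mem_of_conn_of_closed_boundary (G.flipQ_closed_boundary hρ) hu h)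

/-- **Paths from outside the closed cluster are paths of `ρ`**: they never enter the cluster, and off the
cluster the flip changes nothing. -/
theorem conn_of_conn_flipQ {c : V} {e : E} {ρ : Config E} (hρ : ρ e = false) {u v : V}
    (hu : u ∉ G.closedCluster c e ρ) (h : G.Conn (G.flipQ c e ρ) u v) : G.Conn ρ u v := by
  refine (Conn.induction (motive := fun w => w ∉ G.closedCluster c e ρ ∧ G.Conn ρ u w)
    ⟨hu, Conn.refl G ρ u⟩ ?_ h).2
  intro x y _ hxy ih
  obtain ⟨hx, hux⟩ := ih
  obtain ⟨f, hf, hend⟩ := hxy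
  have hb := G.flipQ_closed_boundary hρ f hf
  have hfe : f ≠ e := by
    rintro rfl
    rw [G.flipQ_apply_e, hρ] at hf
    exact Bool.false_ne_true hf
  rcases hend with ⟨rfl, rfl⟩ | ⟨rfl, rfl⟩
  · have hy : G.snd f ∉ G.closedCluster c e ρ := fun h => hx (hb.2 h)
    have hρf : ρ f = true := by
      rw [G.flipQ_apply_of_not c e ρ fun h => h.elim hx hy] at hf
      exact hf
    exact ⟨hy, hux.trans (Conn.of_openAdj (G.openAdj_of_open f hρf))⟩
  · have hy : G.fst f ∉ G.closedCluster c e ρ := fun h => hx (hb.1 h)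
    have hρf : ρ f = true := by
      rw [G.flipQ_apply_of_not c e ρ fun h => h.elim hy hx] at hf
      exact hf
    exact ⟨hy, hux.trans (Conn.of_openAdj (G.openAdj_of_open f hρf)).symm⟩

/-- **The closed cluster stays connected in the flipped configuration**: its closed edges open. -/
theorem conn_flipQ_of_mem {c : V} {e : E} {ρ : Config E} (_hρ : ρ e = false) {u : V}
    (hu : u ∈ G.closedCluster c e ρ) : G.Conn (G.flipQ c e ρ) c u := by
  refine Conn.induction (motive := fun w => G.Conn (G.flipQ c e ρ) c w) (Conn.refl G _ c) ?_ hu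
  intro x y hcx hxy ih
  obtain ⟨f, hf, hend⟩ := hxy
  have hfe : f ≠ e := by
    rintro rfl
    rw [Function.update_self] at hf
    exact Bool.false_ne_true hf
  have hρf : ρ f = false := by
    rw [Function.update_of_ne hfe, compl_apply_bool] at hf
    simpa using hf
  have hmem : G.fst f ∈ G.closedCluster c e ρ ∨ G.snd f ∈ G.closedCluster c e ρ := by
    rcases hend with ⟨rfl, -⟩ | ⟨-, rfl⟩
    · exact Or.inl hcx
    · exact Or.inr hcx
  have hDf : G.flipQ c e ρ f = true := by
    rw [G.flipQ_apply_of_mem c e ρ hfe hmem, hρf]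
    rfl
  exact ih.trans (Conn.of_openAdj ⟨f, hDf, hend⟩)

/-- **The cluster of `c` after the flip is exactly the closed cluster.** -/
theorem cluster_flipQ_eq {c : V} {e : E} {ρ : Config E} (hρ : ρ e = false) :
    G.cluster (G.flipQ c e ρ) c = G.closedCluster c e ρ := by
  ext u
  constructor
  · intro h
    exact mem_of_conn_of_closed_boundary (G.flipQ_closed_boundary hρ) (G.self_mem_closedCluster c e ρ) h
  · intro h
    exact G.conn_flipQ_of_mem hρ h

/-- **The flip is injective on the configurations with `e` closed**: the closed cluster is read off the
image as the cluster of `c`, and then every edge is recovered. -/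
theorem flipQ_injOn {c : V} {e : E} {ρ ρ' : Config E} (hρ : ρ e = false) (hρ' : ρ' e = false)
    (h : G.flipQ c e ρ = G.flipQ c e ρ') : ρ = ρ' := by
  have hQ : G.closedCluster c e ρ = G.closedCluster c e ρ' := by
    rw [← G.cluster_flipQ_eq hρ, ← G.cluster_flipQ_eq hρ', h]
  funext f
  by_cases hfe : f = e
  · subst hfe
    rw [hρ, hρ']
  · have h1 := congrFun h f
    by_cases hm : G.fst f ∈ G.closedCluster c e ρ ∨ G.snd f ∈ G.closedCluster c e ρ
    · have hm' : G.fst f ∈ G.closedCluster c e ρ' ∨ G.snd f ∈ G.closedCluster c e ρ' := hQ ▸ hm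
      rw [G.flipQ_apply_of_mem c e ρ hfe hm, G.flipQ_apply_of_mem c e ρ' hfe hm'] at h1
      exact Bool.not_inj h1
    · have hm' : ¬ (G.fst f ∈ G.closedCluster c e ρ' ∨ G.snd f ∈ G.closedCluster c e ρ') := hQ ▸ hm
      rw [G.flipQ_apply_of_not c e ρ hm, G.flipQ_apply_of_not c e ρ' hm'] at h1
      exact h1

/-! ### The `c–a` edge is a theorem -/

variable [Fintype E]

open Classical in
/-- **The counting inequality at a `c–a` edge**: the closed-cluster flip injects
`{e closed, a ≁ b, c ~ b, c iso in the antipode}` into `{e closed, a ≁ b, c ≁ b}`. -/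
theorem card_crosswise_le_of_isCAEdge {a b c : V} {e : E} (_he : G.IsABEdge c a e) :
    (Finset.univ.filter fun ρ : Config E => ρ e = false ∧ ¬ G.Conn ρ a b ∧ G.Conn ρ c b ∧
        G.IsCIso (Function.update ρᶜ e false) a b c).card ≤
      (Finset.univ.filter fun ρ : Config E =>
        ρ e = false ∧ ¬ G.Conn ρ a b ∧ ¬ G.Conn ρ c b).card := by
  refine Finset.card_le_card_of_injOn (G.flipQ c e) ?_ ?_
  · intro ρ hρ
    obtain ⟨-, h0, h1, -, h3⟩ := Finset.mem_filter.1 (Finset.mem_coe.1 hρ)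
    have ha : a ∉ G.closedCluster c e ρ := fun h => h3.1 h.symm
    have hb : b ∉ G.closedCluster c e ρ := fun h => h3.2 h.symm
    refine Finset.mem_coe.2 (Finset.mem_filter.2 ⟨Finset.mem_univ _, ?_, ?_, ?_⟩)
    · rw [G.flipQ_apply_e]
      exact h0
    · exact fun h => h1 (G.conn_of_conn_flipQ h0 ha h)
    · exact G.not_conn_flipQ_of_mem_of_notMem h0 (G.self_mem_closedCluster c e ρ) hb
  · intro ρ hρ ρ' hρ' h
    exact G.flipQ_injOn (Finset.mem_filter.1 (Finset.mem_coe.1 hρ)).2.1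
      (Finset.mem_filter.1 (Finset.mem_coe.1 hρ')).2.1 h

/-- **`OneEdgeMonoC026` holds at every `c–a` edge of every marked multigraph.** -/
theorem cubeSumQuad_deleteEdge_le_of_isCAEdge {a b c : V} {e : E} (he : G.IsABEdge c a e) :
    (G.deleteEdge e).cubeSumQuad ![a, b, c] kernel26 ≤ G.cubeSumQuad ![a, b, c] kernel26 :=
  (G.deleteEdge_le_iff_of_isCAEdge he).2 (G.card_crosswise_le_of_isCAEdge he)

/-! ### The `c–b` edge by the `a ↔ b` symmetry -/

open Classical in
/-- **The class sum of `kernel26` is symmetric in the marks `a, b`.** -/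
theorem cubeSumQuad_kernel26_swap (a b c : V) :
    G.cubeSumQuad ![a, b, c] kernel26 = G.cubeSumQuad ![b, a, c] kernel26 := by
  rw [G.cubeSumQuad_kernel26_eq, G.cubeSumQuad_kernel26_eq]
  congr 2
  · refine congrArg Finset.card (Finset.filter_congr fun ρ _ => ?_)
    unfold OnePair
    constructor
    · rintro (⟨h1, h2⟩ | ⟨h1, h2⟩ | ⟨h1, h2⟩)
      · exact Or.inl ⟨h1.symm, fun h => h2 (h1.trans h)⟩
      · exact Or.inr (Or.inr ⟨h1, fun h => h2 h.symm⟩)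
      · exact Or.inr (Or.inl ⟨h1, fun h => h2 h.symm⟩)
    · rintro (⟨h1, h2⟩ | ⟨h1, h2⟩ | ⟨h1, h2⟩)
      · exact Or.inl ⟨h1.symm, fun h => h2 (h1.trans h)⟩
      · exact Or.inr (Or.inr ⟨h1, fun h => h2 h.symm⟩)
      · exact Or.inr (Or.inl ⟨h1, fun h => h2 h.symm⟩)
  · refine congrArg Finset.card (Finset.filter_congr fun ρ _ => ?_)
    unfold IsCIso
    constructor
    · rintro ⟨h1, h2, h3⟩
      exact ⟨h1.symm, h3, h2⟩
    · rintro ⟨h1, h2, h3⟩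
      exact ⟨h1.symm, h3, h2⟩

/-- **`OneEdgeMonoC026` holds at every `c–b` edge of every marked multigraph.** -/
theorem cubeSumQuad_deleteEdge_le_of_isCBEdge {a b c : V} {e : E} (he : G.IsABEdge c b e) :
    (G.deleteEdge e).cubeSumQuad ![a, b, c] kernel26 ≤ G.cubeSumQuad ![a, b, c] kernel26 := by
  rw [G.cubeSumQuad_kernel26_swap, (G.deleteEdge e).cubeSumQuad_kernel26_swap]
  exact G.cubeSumQuad_deleteEdge_le_of_isCAEdge he

/-- **The whole mark–mark type of `OneEdgeMonoC026` is a theorem**: at every edge joining two of the marks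
`a, b, c`, on every marked multigraph, `CS(G − e) ≤ CS(G)` (the `a–b` edge is a tie,
`cubeSumQuad_deleteEdge_eq_of_isABEdge`; the `c–a` / `c–b` edges by the closed-cluster flip). -/
theorem cubeSumQuad_deleteEdge_le_of_markMark {a b c : V} {e : E}
    (he : G.IsABEdge a b e ∨ G.IsABEdge c a e ∨ G.IsABEdge c b e) :
    (G.deleteEdge e).cubeSumQuad ![a, b, c] kernel26 ≤ G.cubeSumQuad ![a, b, c] kernel26 := by
  rcases he with h | h | h
  · exact le_of_eq (G.cubeSumQuad_deleteEdge_eq_of_isABEdge h)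
  · exact G.cubeSumQuad_deleteEdge_le_of_isCAEdge h
  · exact G.cubeSumQuad_deleteEdge_le_of_isCBEdge h

end MultiGraph

/-! ### The residue: the hypothesis of record is equivalent to its restriction to edges avoiding `a` and `b` -/

/-- **The residual one-edge hypothesis**: `OneEdgeMonoC026` asked only at the edges with NO endpoint in
`{a, b}` — the `c`–non-mark and non-mark–non-mark edges (on a simple graph every other removable edge joins
two marks). -/
def OneEdgeMonoC026Res : Prop :=
  ∀ {V E : Type} [Fintype V] [Fintype E] [DecidableEq E] (G : MultiGraph V E), G.IsSimple →
    ∀ a b c : V, a ≠ b → a ≠ c → b ≠ c → ∀ e : E,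
      G.fst e ≠ a → G.fst e ≠ b → G.snd e ≠ a → G.snd e ≠ b →
        (G.deleteEdge e).cubeSumQuad ![a, b, c] kernel26 ≤ G.cubeSumQuad ![a, b, c] kernel26

/-- **The hypothesis of record is equivalent to its residue**: the removable edges with an endpoint in
`{a, b}` are the mark–mark edges, where the monotonicity is a theorem
(`cubeSumQuad_deleteEdge_le_of_markMark`). -/
theorem oneEdgeMonoC026_iff_res : OneEdgeMonoC026 ↔ OneEdgeMonoC026Res := by
  constructor
  · intro h V E _ _ _ G hs a b c hab hac hbc e h1 h2 h3 h4
    refine h G hs a b c hab hac hbc e ?_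
    rintro (⟨h5, -⟩ | ⟨h5, -⟩)
    · rcases h5 with h5 | h5
      · exact h1 h5
      · exact h2 h5
    · rcases h5 with h5 | h5
      · exact h3 h5
      · exact h4 h5
  · intro h V E _ _ _ G hs a b c hab hac hbc e he
    by_cases h1 : G.fst e = a
    · -- `snd e ∈ {a, b, c}` (else `e` is of type a/b–non-mark); `snd e ≠ a` (simple)
      have hne : G.snd e ≠ a := fun h' => hs.1 e (h1.trans h'.symm)
      by_cases h2 : G.snd e = b
      · exact G.cubeSumQuad_deleteEdge_le_of_markMark (Or.inl (Or.inl ⟨h1, h2⟩))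
      · by_cases h3 : G.snd e = c
        · exact G.cubeSumQuad_deleteEdge_le_of_markMark (Or.inr (Or.inl (Or.inr ⟨h1, h3⟩)))
        · exact absurd (Or.inl ⟨Or.inl h1, hne, h2, h3⟩) he
    · by_cases h1' : G.fst e = b
      · have hne : G.snd e ≠ b := fun h' => hs.1 e (h1'.trans h'.symm)
        by_cases h2 : G.snd e = a
        · exact G.cubeSumQuad_deleteEdge_le_of_markMark (Or.inl (Or.inr ⟨h1', h2⟩))
        · by_cases h3 : G.snd e = c
          · exact G.cubeSumQuad_deleteEdge_le_of_markMark (Or.inr (Or.inr (Or.inr ⟨h1', h3⟩)))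
          · exact absurd (Or.inl ⟨Or.inr h1', h2, hne, h3⟩) he
      · by_cases h2 : G.snd e = a
        · by_cases h3 : G.fst e = c
          · exact G.cubeSumQuad_deleteEdge_le_of_markMark (Or.inr (Or.inl (Or.inl ⟨h3, h2⟩)))
          · exact absurd (Or.inr ⟨Or.inl h2, h1, h1', h3⟩) he
        · by_cases h2' : G.snd e = b
          · by_cases h3 : G.fst e = c
            · exact G.cubeSumQuad_deleteEdge_le_of_markMark (Or.inr (Or.inr (Or.inl ⟨h3, h2'⟩)))
            · exact absurd (Or.inr ⟨Or.inr h2', h1, h1', h3⟩) he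
          · exact h G hs a b c hab hac hbc e h1 h1' h2 h2'

end PercRepro
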